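import Summits.QuantumFields.YangMills.Theorems.AlphaInputsT3ACv3PerturbedPlaquetteFrame
import Summits.QuantumFields.YangMills.Theorems.AlphaInputsT3ACv3LinearLiftMatrixLift
import HarnessLib

/-!
# `AlphaInputsT3ACv3FLPlaqUpdateCurl` — STRATEGY B for 2′, non-abelian (FL), row R6 PLAQUETTE BOOKKEEPING of the exponential update in `curlM` currency and its SUMMABLE ITERATION:
# `dist1 U′(∂p) ≤ dist1 U(∂p) + ‖curlM a (p)‖ + 16αδ + 16α²` for `U′_b = e^{a_b}U_b` (★w4's covariant ledger + η-form, read through the matrix port's `curlM`), hence along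
# `U (j+1) = e^{a j}·U j`: `dist1 (U J)(∂p) ≤ dist1 (U 0)(∂p) + Σ_{j<J} (‖curlM (a j) (p)‖ + 16·α j·δ + 16·(α j)²)` — NO pure `δ²` term, the increments are summable —
# cell `ym3-torus`, width seat `ym-ust-19936-w3` (g0)

WHY (★w1-19936 g0 DONE∕HANDOFF 2026-08-28T01:28:57Z: «NOT LANDED: PlaqUpdate … needed so plaquette increments are SUMMABLE along the iteration»; ★w4-19936 g0 DEDUP 01:33:51Z: the
one-step near-flat row is HIS `PerturbedPlaquetteFrame.norm_covCurl_sub_flatCurl_le_eta` ∕ `dist1_plaqHol_perturb_le_frame` (p593872) — «take the `curlM`-currency corollary … and the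
SUMMABLE ITERATION form on top of it by name — that telescope IS new and yours»).  THIS FILE does exactly that, citing ★w4's `PerturbedPlaquette.dist1_plaqHol_perturb_le`,
`PerturbedPlaquetteFrame.norm_covCurl_sub_flatCurl_le_eta`, `PerturbedPlaquette.exp_four_mul_sub_le_sq` BY NAME (no re-derivation):
* `curlM_eq_flatCurl` (the matrix port's `curlM a p.src p.μ p.ν` IS the flat four-term sum `a₁ + a₂ − a₃ − a₄` of the ledger, `rfl`);
* ★ `dist1_plaqHol_expUpdate_le`: `dist1 U′(∂p) ≤ dist1 U(∂p) + ‖curlM a p.src p.μ p.ν‖ + 16αδ + 16α²` (`‖a_b‖ ≤ α` on the four bonds, `4α ≤ 1`, `‖U_b − 1‖ ≤ δ` on the four bonds);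
* ★★ `dist1_plaqHol_iterate_le`: the summable iteration along `U (j+1) = e^{a j}·U j`; with the Newton update `a j = liftSM k (u j)` the curl term is `≤ 4·18^d‖u j‖∕L^{2k}`
  (`…LinearLiftMatrixCLM.norm_curlM_liftSCLM_le`) and `α j ≤ (C_S∕L^k)‖u j‖` (`norm_liftSM_le`), so every summand is `O(‖u j‖·(L^{−2k} + δL^{−k} + ‖u j‖L^{−2k}))`.
HONEST FRAMING.  Bookkeeping over ★w4's landed identities; `hLift`∕(FL), the stub 2′χ, the crux `HistoryTailL` and any gap are NOT claimed; count-neutral helper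
(`--supports stmt-QuantumFields-19936`); registry untouched.  YM₃ on the three-torus is a RUNG of the programme, not the Clay problem; nothing here is about d = 4, infinite
volume or a mass gap.

References: T. Bałaban, Commun. Math. Phys. 98 (1985) 17–51 [Balaban1985Averaging] ((9) p.19, (19) p.21); Commun. Math. Phys. 99 (1985) 75–102 [Balaban1985RegularSpaces]
(p.84, the second-order remainder of the plaquette of a perturbed configuration).
-/

set_option autoImplicit false

noncomputable section

open scoped Matrix.Norms.L2Operator
open NormedSpace

namespace Summit.QuantumFields.YangMills.Theorems.LinearLiftMatrix

open Finset
open Literature.MathematicalPhysics.QuantumFieldTheory.Balaban1983to89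
open Literature.MathematicalPhysics.QuantumFieldTheory.Balaban1985CMP102.Setting
open Summit.QuantumFields.YangMills.Theorems.PerturbedPlaquette (dist1_plaqHol_perturb_le exp_four_mul_sub_le_sq)
open Summit.QuantumFields.YangMills.Theorems.PerturbedPlaquetteFrame (norm_covCurl_sub_flatCurl_le_eta)

variable {n : Type*} [Fintype n] [DecidableEq n] [Nonempty n] {P : Params} {j : ℕ}

omit [Fintype n] [DecidableEq n] [Nonempty n] in
/-- The matrix port's curl IS the flat four-term sum of ★w4's plaquette ledger: `curlM a p.src p.μ p.ν = a₁ + a₂ − a₃ − a₄`. [cite: Balaban1985Averaging, (9) p.19] -/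
theorem curlM_eq_flatCurl (a : PBond P j → Matrix n n ℂ) (p : Plaq P j) :
    curlM a p.src p.μ p.ν = a ⟨p.src, p.μ⟩ + a ⟨p.src.shift p.μ, p.ν⟩ - a ⟨p.src.shift p.ν, p.μ⟩ - a ⟨p.src, p.ν⟩ := rfl

/-- **★ THE PLAQUETTE OF THE EXPONENTIAL UPDATE IN `curlM` CURRENCY**: for `U′_b = e^{a_b}U_b` (`a_b* = −a_b`, `‖a_b‖ ≤ α` on the four bonds of `p`, `4α ≤ 1`) over a background
whose four bonds of `p` are within `δ` of `1`: `dist1 U′(∂p) ≤ dist1 U(∂p) + ‖curlM a p.src p.μ p.ν‖ + 16αδ + 16α²` (★w4's `dist1_plaqHol_perturb_le` + `norm_covCurl_sub_flatCurl_le_eta`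
+ `exp_four_mul_sub_le_sq`, by name). [cite: Balaban1985Averaging, (9) p.19, (19) p.21; Balaban1985RegularSpaces, p.84] -/
theorem dist1_plaqHol_expUpdate_le (U U' : GaugeField P j (Matrix.specialUnitaryGroup n ℂ)) (a : PBond P j → Matrix n n ℂ)
    (hstar : ∀ b, star (a b) = -a b) (hU' : ∀ b, ((U' b : Matrix.specialUnitaryGroup n ℂ) : Matrix n n ℂ) = exp (a b) * (U b : Matrix n n ℂ))
    (p : Plaq P j) {α δ : ℝ} (hα : 0 ≤ α) (h4 : 4 * α ≤ 1)
    (h₁ : ‖a ⟨p.src, p.μ⟩‖ ≤ α) (h₂ : ‖a ⟨p.src.shift p.μ, p.ν⟩‖ ≤ α) (h₃ : ‖a ⟨p.src.shift p.ν, p.μ⟩‖ ≤ α) (h₄ : ‖a ⟨p.src, p.ν⟩‖ ≤ α)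
    (hU₁ : ‖(U ⟨p.src, p.μ⟩ : Matrix n n ℂ) - 1‖ ≤ δ) (hU₂ : ‖(U ⟨p.src.shift p.μ, p.ν⟩ : Matrix n n ℂ) - 1‖ ≤ δ) (hU₃ : ‖(U ⟨p.src.shift p.ν, p.μ⟩ : Matrix n n ℂ) - 1‖ ≤ δ)
    (hU₄ : ‖(U ⟨p.src, p.ν⟩ : Matrix n n ℂ) - 1‖ ≤ δ) :
    GaugeGroup.dist1 (GaugeField.plaqHol U' p) ≤ GaugeGroup.dist1 (GaugeField.plaqHol U p) + ‖curlM a p.src p.μ p.ν‖ + 16 * α * δ + 16 * α ^ 2 := by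
  have hP := dist1_plaqHol_perturb_le U U' a hstar hU' p h₁ h₂ h₃ h₄
  have hF := norm_covCurl_sub_flatCurl_le_eta U a p hU₁ hU₂ hU₃ hU₄ h₂ h₃ h₄
  have hE := exp_four_mul_sub_le_sq hα h4
  have key : ∀ (X C : Matrix n n ℂ) (s : ℝ), ‖X - C‖ ≤ s → ‖X‖ ≤ ‖C‖ + s := fun X C s h => (norm_le_insert' X C).trans (by linarith)
  have hX := key _ _ _ hF
  rw [← curlM_eq_flatCurl] at hX
  generalize ‖curlM a p.src p.μ p.ν‖ = c at hX ⊢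
  generalize GaugeGroup.dist1 (GaugeField.plaqHol U' p) = d' at hP ⊢
  generalize GaugeGroup.dist1 (GaugeField.plaqHol U p) = d at hP ⊢
  linarith

/-- **★★ THE SUMMABLE ITERATION**: along `U (j+1) = e^{a j}·U j` (`a j` skew-Hermitian, `‖a j‖ ≤ α j`, `4·α j ≤ 1`, every `U j` within `δ` of `1` bondwise),
`dist1 (U J)(∂p) ≤ dist1 (U 0)(∂p) + Σ_{j<J} (‖curlM (a j) p.src p.μ p.ν‖ + 16·α j·δ + 16·(α j)²)` — the plaquette increments are the curls of the corrections plus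
`O(α_j(α_j + δ))`, summable when `Σ α_j < ∞`; NO pure `δ²` term. [cite: Balaban1985RegularSpaces, p.84] -/
theorem dist1_plaqHol_iterate_le (U : ℕ → GaugeField P j (Matrix.specialUnitaryGroup n ℂ)) (a : ℕ → PBond P j → Matrix n n ℂ) (α : ℕ → ℝ) {δ : ℝ}
    (hstar : ∀ i b, star (a i b) = -a i b) (hU' : ∀ i b, ((U (i + 1) b : Matrix.specialUnitaryGroup n ℂ) : Matrix n n ℂ) = exp (a i b) * (U i b : Matrix n n ℂ))
    (hα : ∀ i, 0 ≤ α i) (h4 : ∀ i, 4 * α i ≤ 1) (ha : ∀ i b, ‖a i b‖ ≤ α i) (hU : ∀ i b, ‖(U i b : Matrix n n ℂ) - 1‖ ≤ δ) (p : Plaq P j) :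
    ∀ J : ℕ, GaugeGroup.dist1 (GaugeField.plaqHol (U J) p) ≤ GaugeGroup.dist1 (GaugeField.plaqHol (U 0) p) +
      ∑ i ∈ range J, (‖curlM (a i) p.src p.μ p.ν‖ + 16 * α i * δ + 16 * α i ^ 2)
  | 0 => by simp
  | J + 1 => by
    have ih := dist1_plaqHol_iterate_le U a α hstar hU' hα h4 ha hU p J
    have hstep := dist1_plaqHol_expUpdate_le (U J) (U (J + 1)) (a J) (hstar J) (hU' J) p (hα J) (h4 J) (ha J _) (ha J _) (ha J _) (ha J _)
      (hU J _) (hU J _) (hU J _) (hU J _)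
    rw [sum_range_succ]
    linarith

/-- **THE SUMMABLE ITERATION WITH A PRESCRIBED BUDGET**: if moreover `dist1 (U 0)(∂p) ≤ η₀` and `Σ_{j<J} (‖curlM (a j) (p)‖ + 16·α j·δ + 16·(α j)²) ≤ Σ∞` for every `J`, then every
iterate has `dist1 (U J)(∂p) ≤ η₀ + Σ∞` — the form the limit field inherits by continuity of `dist1`. [cite: Balaban1985RegularSpaces, p.84] -/
theorem dist1_plaqHol_iterate_le_of_budget (U : ℕ → GaugeField P j (Matrix.specialUnitaryGroup n ℂ)) (a : ℕ → PBond P j → Matrix n n ℂ) (α : ℕ → ℝ) {δ η₀ S : ℝ}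
    (hstar : ∀ i b, star (a i b) = -a i b) (hU' : ∀ i b, ((U (i + 1) b : Matrix.specialUnitaryGroup n ℂ) : Matrix n n ℂ) = exp (a i b) * (U i b : Matrix n n ℂ))
    (hα : ∀ i, 0 ≤ α i) (h4 : ∀ i, 4 * α i ≤ 1) (ha : ∀ i b, ‖a i b‖ ≤ α i) (hU : ∀ i b, ‖(U i b : Matrix n n ℂ) - 1‖ ≤ δ) (p : Plaq P j)
    (h0 : GaugeGroup.dist1 (GaugeField.plaqHol (U 0) p) ≤ η₀)
    (hS : ∀ J, ∑ i ∈ range J, (‖curlM (a i) p.src p.μ p.ν‖ + 16 * α i * δ + 16 * α i ^ 2) ≤ S) (J : ℕ) :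
    GaugeGroup.dist1 (GaugeField.plaqHol (U J) p) ≤ η₀ + S :=
  (dist1_plaqHol_iterate_le U a α hstar hU' hα h4 ha hU p J).trans (add_le_add h0 (hS J))

end Summit.QuantumFields.YangMills.Theorems.LinearLiftMatrix

end
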